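import Literature.NumberTheory.Transcendental.KZCalculusProofs
import Mathlib.Analysis.RCLike.Sqrt
import Mathlib.RingTheory.Algebraic.Basic
import Mathlib.Algebra.Polynomial.Roots
import Mathlib.Topology.MetricSpace.Pseudo.Defs
import HarnessLib

/-!
# Real and imaginary parts of algebraic expressions are `ℚ`-semialgebraic functions

Auxiliary file for the discharge of
`Literature.NumberTheory.Transcendental.isPeriod_of_mem_lattice` (elliptic periods are
Kontsevich–Zagier periods, `KontsevichZagier.lean`). Kontsevich–Zagier [KZ 2001, §1.1, remark
after the Definition] allow, in an integral representation of a period, algebraic functions and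
algebraic (rather than rational) coefficients; in the tree this is the theorem
`KZ.isRealPeriod_iff_exists_integralRep_holds` (real periods are the values of absolutely
convergent integrals of `ℚ`-semialgebraic functions over `ℚ`-semialgebraic domains), resting on
the Tarski–Seidenberg theorem `Literature.ModelTheory.ExponentialFields.tarski_seidenberg_real_holds`.
To feed it with the integrands `s ↦ re (w / √(4 x(s)³ − g₂ x(s) − g₃))` of elliptic integrals
along segments we record here, as sorry-free lemmas and with no new definitions:

* `IsSemialgebraicFunOn.inv` — the inverse of a non-vanishing real semialgebraic function is
  semialgebraic (graph elimination, Bochnak–Coste–Roy Prop. 2.2.6);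
* `isSemialgebraic_setOf_apply_eq_of_isAlgebraic`, `isSemialgebraicFunOn_const_of_isAlgebraic` —
  a real algebraic number `c` is `ℚ`-definable (`{t | t = c} = {t | f t = 0, a < t < b}` for
  `f ∈ ℚ[X]` with `f c = 0` and an isolating rational interval `(a, b)`), so constant functions
  with real-algebraic values are `ℚ`-semialgebraic [KZ 2001, §1.1: "algebraic" may replace
  "rational"; Huber–Müller-Stach 2017, §12.2];
* closure of the class of complex-valued functions `F` on `s ⊆ ℝᵐ` whose real and imaginary parts
  are `ℚ`-semialgebraic under `+`, `-`, `*`, `⁻¹`, powers, `‖·‖` and the principal square root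
  `Complex.sqrt` (`re √z = √((‖z‖ + re z)/2)`, `im √z = ± √((‖z‖ − re z)/2)` by the sign of `im z`,
  Mathlib `Complex.cpow_inv_two_re/im_eq_sqrt/im_eq_neg_sqrt`), stated with the two hypotheses
  `re ∘ F`, `im ∘ F` semialgebraic and conclusions of the same shape (`…re_im_add`, `…_mul`,
  `…_inv`, `…_sqrt`, …).

## References

* M. Kontsevich, D. Zagier, *Periods*, in: Mathematics Unlimited — 2001 and Beyond, Springer
  (2001), §1.1.
* J. Bochnak, M. Coste, M.-F. Roy, *Real Algebraic Geometry*, Springer (1998), §2.2,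
  Prop. 2.2.6.
* A. Huber, S. Müller-Stach, *Periods and Nori Motives*, Springer (2017), §12.2.
-/

noncomputable section

open Set MvPolynomial
open Literature.ModelTheory.ExponentialFields

namespace Literature.NumberTheory.Transcendental

/-! ### Inverses of real semialgebraic functions -/

section RealInv

variable {k : Type*} [CommRing k] [Algebra k ℝ] {m : ℕ} {s : Set (Fin m → ℝ)}
  {f g : (Fin m → ℝ) → ℝ}

/-- The inverse of a non-vanishing real semialgebraic function is semialgebraic: the graph of
`f⁻¹` over `s` is `{(x, w) | x ∈ s, (x, w, f x) ∈ T}` with `T = {(x, w, y) | w * y = 1}` (graph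
elimination, Tarski–Seidenberg). [cite: BochnakCosteRoy1998, Prop. 2.2.6] -/
theorem IsSemialgebraicFunOn.inv (hf : IsSemialgebraicFunOn k s f) (h0 : ∀ x ∈ s, f x ≠ 0) :
    IsSemialgebraicFunOn k s (fun x => (f x)⁻¹) := by
  have hT : IsSemialgebraic k {u : Fin (m + 2) → ℝ |
      u (Fin.castSucc (Fin.last m)) * u (Fin.last (m + 1)) = 1} := by
    have := isSemialgebraic_setOf_eval_eq_zero (k := k) (R := ℝ)
      (X (Fin.castSucc (Fin.last m)) * X (Fin.last (m + 1)) - 1 : MvPolynomial (Fin (m + 2)) k)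
    simpa [sub_eq_zero] using this
  rw [isSemialgebraicFunOn_iff]
  convert hf.isSemialgebraic_setOf_snoc_mem tarski_seidenberg_real_holds hT using 1
  ext v
  simp only [mem_setOf_eq, Fin.snoc_castSucc, Fin.snoc_last]
  exact and_congr_right fun hv => (mul_eq_one_iff_eq_inv₀ (h0 _ hv)).symm

/-- The quotient of two real semialgebraic functions, the denominator non-vanishing, is
semialgebraic. [cite: BochnakCosteRoy1998, Prop. 2.2.6] -/
theorem IsSemialgebraicFunOn.div (hf : IsSemialgebraicFunOn k s f) (hg : IsSemialgebraicFunOn k s g)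
    (h0 : ∀ x ∈ s, g x ≠ 0) : IsSemialgebraicFunOn k s (fun x => f x / g x) :=
  (IsSemialgebraicFunOn.mul_holds hf (hg.inv h0)).congr fun x _ => by simp [div_eq_mul_inv]

/-- The subset of `s` where a semialgebraic function is non-negative is semialgebraic
(graph elimination). [cite: BochnakCosteRoy1998, §2.2] -/
theorem IsSemialgebraicFunOn.isSemialgebraic_sep_nonneg (hf : IsSemialgebraicFunOn k s f) :
    IsSemialgebraic k {x | x ∈ s ∧ 0 ≤ f x} := by
  have hT : IsSemialgebraic k {z : Fin (m + 1) → ℝ | 0 ≤ z (Fin.last m)} := by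
    simpa using isSemialgebraic_setOf_eval_nonneg (k := k) (R := ℝ) (X (Fin.last m))
  convert hf.isSemialgebraic_sep_snoc_mem tarski_seidenberg_real_holds hT using 1
  ext x
  simp

/-- The subset of `s` where a semialgebraic function is negative is semialgebraic
(graph elimination). [cite: BochnakCosteRoy1998, §2.2] -/
theorem IsSemialgebraicFunOn.isSemialgebraic_sep_neg (hf : IsSemialgebraicFunOn k s f) :
    IsSemialgebraic k {x | x ∈ s ∧ f x < 0} := by
  have hT : IsSemialgebraic k {z : Fin (m + 1) → ℝ | z (Fin.last m) < 0} := by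
    simpa using isSemialgebraic_setOf_eval_pos (k := k) (R := ℝ) (-X (Fin.last m))
  convert hf.isSemialgebraic_sep_snoc_mem tarski_seidenberg_real_holds hT using 1
  ext x
  simp

end RealInv

/-! ### Real algebraic constants are `ℚ`-semialgebraic -/

section AlgebraicConst

variable {m n : ℕ}

/-- A real algebraic number is `ℚ`-definable: if `c ∈ ℝ` is algebraic over `ℚ` then the
coordinate hyperplane `{z | z i = c} ⊆ ℝⁿ` is `ℚ`-semialgebraic, being
`{z | f (z i) = 0, a < z i < b}` for any `0 ≠ f ∈ ℚ[X]` vanishing at `c` and rationals `a < c < b`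
isolating `c` among the finitely many real roots of `f`.
[Kontsevich–Zagier 2001, §1.1 ("rational" may be replaced by "algebraic");
Huber–Müller-Stach 2017, §12.2] [cite: KontsevichZagier2001, §1.1] -/
theorem isSemialgebraic_setOf_apply_eq_of_isAlgebraic {c : ℝ} (hc : IsAlgebraic ℚ c) (i : Fin n) :
    IsSemialgebraic ℚ {z : Fin n → ℝ | z i = c} := by
  obtain ⟨f, hf0, hfc⟩ := hc
  have hfin : (f.rootSet ℝ).Finite := Polynomial.rootSet_finite f ℝ
  -- isolate `c` among the real roots of `f`
  obtain ⟨δ, hδ, hfar⟩ : ∃ δ > 0, ∀ t ∈ f.rootSet ℝ, t ≠ c → δ ≤ dist t c := by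
    have hopen : IsOpen (f.rootSet ℝ \ {c})ᶜ :=
      (hfin.subset fun x hx => hx.1).isClosed.isOpen_compl
    obtain ⟨δ, hδ, hsub⟩ := Metric.isOpen_iff.mp hopen c (fun h => h.2 rfl)
    refine ⟨δ, hδ, fun t ht htc => ?_⟩
    by_contra h
    exact hsub (Metric.mem_ball.mpr (not_le.mp h)) ⟨ht, htc⟩
  obtain ⟨a, hca, hac⟩ := exists_rat_btwn (sub_lt_self c hδ)
  obtain ⟨b, hcb, hbc⟩ := exists_rat_btwn (lt_add_of_pos_right c hδ)
  have key : ∀ t : ℝ, t = c ↔ Polynomial.aeval t f = 0 ∧ (a : ℝ) < t ∧ t < b := by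
    intro t
    constructor
    · rintro rfl
      exact ⟨hfc, hac, hcb⟩
    · rintro ⟨ht, h1, h2⟩
      by_contra hne
      have hroot : t ∈ f.rootSet ℝ := Polynomial.mem_rootSet.mpr ⟨hf0, ht⟩
      have hd := hfar t hroot hne
      rw [Real.dist_eq] at hd
      have habs : |t - c| < δ := abs_sub_lt_iff.mpr ⟨by linarith, by linarith⟩
      exact (not_le.mpr habs) hd
  have hset : {z : Fin n → ℝ | z i = c} =
      {z | aeval z (Polynomial.aeval (X i : MvPolynomial (Fin n) ℚ) f) = 0} ∩
        ({z | aeval z (C a : MvPolynomial (Fin n) ℚ) < aeval z (X i : MvPolynomial (Fin n) ℚ)} ∩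
          {z | aeval z (X i : MvPolynomial (Fin n) ℚ) < aeval z (C b : MvPolynomial (Fin n) ℚ)}) := by
    ext z
    have h1 : aeval z (Polynomial.aeval (X i : MvPolynomial (Fin n) ℚ) f) = Polynomial.aeval (z i) f := by
      rw [← Polynomial.aeval_algHom_apply, aeval_X]
    simp only [mem_setOf_eq, mem_inter_iff, h1, aeval_X, aeval_C, eq_ratCast]
    exact key (z i)
  rw [hset]
  exact (isSemialgebraic_setOf_eval_eq_zero _).inter
    ((isSemialgebraic_setOf_eval_lt _ _).inter (isSemialgebraic_setOf_eval_lt _ _))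

/-- Constant functions with real-algebraic value are `ℚ`-semialgebraic on every `ℚ`-semialgebraic
set: the graph is the cylinder over `s` cut by the `ℚ`-definable hyperplane `{w = c}`.
[Kontsevich–Zagier 2001, §1.1; Huber–Müller-Stach 2017, §12.2] [cite: KontsevichZagier2001, §1.1] -/
theorem isSemialgebraicFunOn_const_of_isAlgebraic {s : Set (Fin m → ℝ)} (hs : IsSemialgebraic ℚ s)
    {c : ℝ} (hc : IsAlgebraic ℚ c) : IsSemialgebraicFunOn ℚ s (fun _ => c) := by
  rw [isSemialgebraicFunOn_iff]
  convert hs.setOf_init_mem.inter (isSemialgebraic_setOf_apply_eq_of_isAlgebraic hc (Fin.last m))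
    using 1
  ext z
  simp

end AlgebraicConst

/-! ### Complex-valued functions with semialgebraic real and imaginary parts -/

section ComplexValued

variable {m : ℕ} {s : Set (Fin m → ℝ)} {F G : (Fin m → ℝ) → ℂ}

/-- Constant complex functions whose value has algebraic real and imaginary parts have
`ℚ`-semialgebraic real and imaginary parts. [cite: KontsevichZagier2001, §1.1] -/
theorem re_im_const (hs : IsSemialgebraic ℚ s) {c : ℂ} (hre : IsAlgebraic ℚ c.re)
    (him : IsAlgebraic ℚ c.im) :
    IsSemialgebraicFunOn ℚ s (fun _ => c.re) ∧ IsSemialgebraicFunOn ℚ s (fun _ => c.im) :=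
  ⟨isSemialgebraicFunOn_const_of_isAlgebraic hs hre, isSemialgebraicFunOn_const_of_isAlgebraic hs him⟩

/-- A real semialgebraic function viewed as a complex-valued one has semialgebraic real and
imaginary parts. [cite: BochnakCosteRoy1998, §2.2] -/
theorem re_im_ofReal (hs : IsSemialgebraic ℚ s) {f : (Fin m → ℝ) → ℝ}
    (hf : IsSemialgebraicFunOn ℚ s f) :
    IsSemialgebraicFunOn ℚ s (fun x => ((f x : ℝ) : ℂ).re) ∧
      IsSemialgebraicFunOn ℚ s (fun x => ((f x : ℝ) : ℂ).im) := by
  refine ⟨by simpa using hf, ?_⟩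
  simpa using isSemialgebraicFunOn_natCast (k := ℚ) (R := ℝ) hs 0

/-- Sums: `re (F + G) = re F + re G`, `im (F + G) = im F + im G`.
[cite: BochnakCosteRoy1998, Prop. 2.2.6] -/
theorem re_im_add
    (hF : IsSemialgebraicFunOn ℚ s (fun x => (F x).re) ∧ IsSemialgebraicFunOn ℚ s (fun x => (F x).im))
    (hG : IsSemialgebraicFunOn ℚ s (fun x => (G x).re) ∧ IsSemialgebraicFunOn ℚ s (fun x => (G x).im)) :
    IsSemialgebraicFunOn ℚ s (fun x => (F x + G x).re) ∧
      IsSemialgebraicFunOn ℚ s (fun x => (F x + G x).im) := by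
  refine ⟨?_, ?_⟩
  · exact (IsSemialgebraicFunOn.add_holds hF.1 hG.1).congr fun x _ => by simp
  · exact (IsSemialgebraicFunOn.add_holds hF.2 hG.2).congr fun x _ => by simp

/-- Negatives. [cite: BochnakCosteRoy1998, Prop. 2.2.6] -/
theorem re_im_neg
    (hF : IsSemialgebraicFunOn ℚ s (fun x => (F x).re) ∧ IsSemialgebraicFunOn ℚ s (fun x => (F x).im)) :
    IsSemialgebraicFunOn ℚ s (fun x => (-F x).re) ∧
      IsSemialgebraicFunOn ℚ s (fun x => (-F x).im) := by
  refine ⟨?_, ?_⟩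
  · exact hF.1.neg.congr fun x _ => by simp
  · exact hF.2.neg.congr fun x _ => by simp

/-- Differences. [cite: BochnakCosteRoy1998, Prop. 2.2.6] -/
theorem re_im_sub
    (hF : IsSemialgebraicFunOn ℚ s (fun x => (F x).re) ∧ IsSemialgebraicFunOn ℚ s (fun x => (F x).im))
    (hG : IsSemialgebraicFunOn ℚ s (fun x => (G x).re) ∧ IsSemialgebraicFunOn ℚ s (fun x => (G x).im)) :
    IsSemialgebraicFunOn ℚ s (fun x => (F x - G x).re) ∧
      IsSemialgebraicFunOn ℚ s (fun x => (F x - G x).im) := by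
  simpa [sub_eq_add_neg] using re_im_add hF (re_im_neg hG)

/-- Products: `re (F G) = re F re G − im F im G`, `im (F G) = re F im G + im F re G`.
[cite: BochnakCosteRoy1998, Prop. 2.2.6] -/
theorem re_im_mul
    (hF : IsSemialgebraicFunOn ℚ s (fun x => (F x).re) ∧ IsSemialgebraicFunOn ℚ s (fun x => (F x).im))
    (hG : IsSemialgebraicFunOn ℚ s (fun x => (G x).re) ∧ IsSemialgebraicFunOn ℚ s (fun x => (G x).im)) :
    IsSemialgebraicFunOn ℚ s (fun x => (F x * G x).re) ∧
      IsSemialgebraicFunOn ℚ s (fun x => (F x * G x).im) := by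
  refine ⟨?_, ?_⟩
  · have := IsSemialgebraicFunOn.sub_holds (IsSemialgebraicFunOn.mul_holds hF.1 hG.1)
      (IsSemialgebraicFunOn.mul_holds hF.2 hG.2)
    exact this.congr fun x _ => by simp [Complex.mul_re]
  · have := IsSemialgebraicFunOn.add_holds (IsSemialgebraicFunOn.mul_holds hF.1 hG.2)
      (IsSemialgebraicFunOn.mul_holds hF.2 hG.1)
    exact this.congr fun x _ => by simp [Complex.mul_im]

/-- Powers. [cite: BochnakCosteRoy1998, Prop. 2.2.6] -/
theorem re_im_pow (hs : IsSemialgebraic ℚ s)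
    (hF : IsSemialgebraicFunOn ℚ s (fun x => (F x).re) ∧ IsSemialgebraicFunOn ℚ s (fun x => (F x).im))
    (n : ℕ) :
    IsSemialgebraicFunOn ℚ s (fun x => (F x ^ n).re) ∧
      IsSemialgebraicFunOn ℚ s (fun x => (F x ^ n).im) := by
  induction n with
  | zero =>
    refine ⟨?_, ?_⟩
    · simpa using isSemialgebraicFunOn_natCast (k := ℚ) (R := ℝ) hs 1
    · simpa using isSemialgebraicFunOn_natCast (k := ℚ) (R := ℝ) hs 0
  | succ n ih => simpa [pow_succ] using re_im_mul ih hF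

/-- The squared norm `normSq F = re F ² + im F ²` is semialgebraic.
[cite: BochnakCosteRoy1998, Prop. 2.2.6] -/
theorem isSemialgebraicFunOn_normSq
    (hF : IsSemialgebraicFunOn ℚ s (fun x => (F x).re) ∧ IsSemialgebraicFunOn ℚ s (fun x => (F x).im)) :
    IsSemialgebraicFunOn ℚ s (fun x => Complex.normSq (F x)) := by
  have := IsSemialgebraicFunOn.add_holds (IsSemialgebraicFunOn.mul_holds hF.1 hF.1)
    (IsSemialgebraicFunOn.mul_holds hF.2 hF.2)
  exact this.congr fun x _ => by simp [Complex.normSq_apply]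

/-- The norm `‖F‖ = √(normSq F)` is semialgebraic. [cite: BochnakCosteRoy1998, Prop. 2.2.6] -/
theorem isSemialgebraicFunOn_norm
    (hF : IsSemialgebraicFunOn ℚ s (fun x => (F x).re) ∧ IsSemialgebraicFunOn ℚ s (fun x => (F x).im)) :
    IsSemialgebraicFunOn ℚ s (fun x => ‖F x‖) := by
  simpa [Complex.norm_def] using IsSemialgebraicFunOn.sqrt_holds (isSemialgebraicFunOn_normSq hF)

/-- Inverses: `re F⁻¹ = re F / normSq F`, `im F⁻¹ = − im F / normSq F` (non-vanishing `F`).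
[cite: BochnakCosteRoy1998, Prop. 2.2.6] -/
theorem re_im_inv
    (hF : IsSemialgebraicFunOn ℚ s (fun x => (F x).re) ∧ IsSemialgebraicFunOn ℚ s (fun x => (F x).im))
    (h0 : ∀ x ∈ s, F x ≠ 0) :
    IsSemialgebraicFunOn ℚ s (fun x => (F x)⁻¹.re) ∧
      IsSemialgebraicFunOn ℚ s (fun x => (F x)⁻¹.im) := by
  have hN : ∀ x ∈ s, Complex.normSq (F x) ≠ 0 := fun x hx => by
    simpa [Complex.normSq_eq_zero] using h0 x hx
  refine ⟨?_, ?_⟩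
  · exact (hF.1.div (isSemialgebraicFunOn_normSq hF) hN).congr fun x _ => by simp [Complex.inv_re]
  · exact (hF.2.div (isSemialgebraicFunOn_normSq hF) hN).neg.congr fun x _ => by
      simp [Complex.inv_im, neg_div]

/-- Quotients. [cite: BochnakCosteRoy1998, Prop. 2.2.6] -/
theorem re_im_div
    (hF : IsSemialgebraicFunOn ℚ s (fun x => (F x).re) ∧ IsSemialgebraicFunOn ℚ s (fun x => (F x).im))
    (hG : IsSemialgebraicFunOn ℚ s (fun x => (G x).re) ∧ IsSemialgebraicFunOn ℚ s (fun x => (G x).im))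
    (h0 : ∀ x ∈ s, G x ≠ 0) :
    IsSemialgebraicFunOn ℚ s (fun x => (F x / G x).re) ∧
      IsSemialgebraicFunOn ℚ s (fun x => (F x / G x).im) := by
  simpa [div_eq_mul_inv] using re_im_mul hF (re_im_inv hG h0)

/-- **The principal square root** `Complex.sqrt z = z ^ (1/2)` of a complex-valued function with
semialgebraic real and imaginary parts has semialgebraic real and imaginary parts:
`re √z = √((‖z‖ + re z)/2)` and `im √z = √((‖z‖ − re z)/2)` where `im z ≥ 0`,
`im √z = −√((‖z‖ − re z)/2)` where `im z < 0` (the two pieces `{im F ≥ 0}`, `{im F < 0}` of `s`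
are semialgebraic by graph elimination and the function is glued along them).
[cite: BochnakCosteRoy1998, Prop. 2.2.6] -/
theorem re_im_sqrt
    (hF : IsSemialgebraicFunOn ℚ s (fun x => (F x).re) ∧ IsSemialgebraicFunOn ℚ s (fun x => (F x).im)) :
    IsSemialgebraicFunOn ℚ s (fun x => (Complex.sqrt (F x)).re) ∧
      IsSemialgebraicFunOn ℚ s (fun x => (Complex.sqrt (F x)).im) := by
  have hs : IsSemialgebraic ℚ s := IsSemialgebraicFunOn.isSemialgebraic_holds hF.1
  have hnorm := isSemialgebraicFunOn_norm hF
  have hhalf : IsSemialgebraicFunOn ℚ s (fun _ => (2 : ℝ)⁻¹) :=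
    (isSemialgebraicFunOn_natCast (k := ℚ) (R := ℝ) hs 2).inv fun _ _ => by norm_num
  -- `re √F = √((‖F‖ + re F) / 2)`
  have hre : IsSemialgebraicFunOn ℚ s (fun x => √((‖F x‖ + (F x).re) / 2)) := by
    have h := IsSemialgebraicFunOn.mul_holds (IsSemialgebraicFunOn.add_holds hnorm hF.1) hhalf
    have h' : IsSemialgebraicFunOn ℚ s (fun x => (‖F x‖ + (F x).re) / 2) :=
      h.congr fun x _ => by simp [div_eq_mul_inv]
    exact IsSemialgebraicFunOn.sqrt_holds h'
  -- `|im √F| = √((‖F‖ - re F) / 2)`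
  have habs : IsSemialgebraicFunOn ℚ s (fun x => √((‖F x‖ - (F x).re) / 2)) := by
    have h := IsSemialgebraicFunOn.mul_holds (IsSemialgebraicFunOn.sub_holds hnorm hF.1) hhalf
    have h' : IsSemialgebraicFunOn ℚ s (fun x => (‖F x‖ - (F x).re) / 2) :=
      h.congr fun x _ => by simp [div_eq_mul_inv]
    exact IsSemialgebraicFunOn.sqrt_holds h'
  refine ⟨hre.congr fun x _ => by rw [Complex.sqrt, Complex.cpow_inv_two_re], ?_⟩
  -- glue the two signs of `im F`
  have hpos : IsSemialgebraic ℚ {x | x ∈ s ∧ 0 ≤ (F x).im} := hF.2.isSemialgebraic_sep_nonneg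
  have hneg : IsSemialgebraic ℚ {x | x ∈ s ∧ (F x).im < 0} := hF.2.isSemialgebraic_sep_neg
  have hunion : s = {x | x ∈ s ∧ 0 ≤ (F x).im} ∪ {x | x ∈ s ∧ (F x).im < 0} := by
    ext x
    simp only [mem_union, mem_setOf_eq]
    constructor
    · intro hx
      rcases le_or_gt 0 (F x).im with h | h
      · exact Or.inl ⟨hx, h⟩
      · exact Or.inr ⟨hx, h⟩
    · rintro (⟨hx, -⟩ | ⟨hx, -⟩) <;> exact hx
  rw [hunion]
  refine IsSemialgebraicFunOn.union (habs.mono (fun x hx => hx.1) hpos)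
    ((habs.mono (fun x hx => hx.1) hneg).neg) ?_ ?_
  · intro x hx
    simp only
    rw [Complex.sqrt, Complex.cpow_inv_two_im_eq_sqrt hx.2]
  · intro x hx
    simp only [Pi.neg_apply]
    rw [Complex.sqrt, Complex.cpow_inv_two_im_eq_neg_sqrt hx.2]

/-- The coordinate `u ↦ (u 0 : ℂ)` on `ℝ¹` has semialgebraic real and imaginary parts on any
`ℚ`-semialgebraic `s ⊆ ℝ¹`. [cite: BochnakCosteRoy1998, §2.2] -/
theorem re_im_coord {s : Set (Fin 1 → ℝ)} (hs : IsSemialgebraic ℚ s) :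
    IsSemialgebraicFunOn ℚ s (fun u => ((u 0 : ℝ) : ℂ).re) ∧
      IsSemialgebraicFunOn ℚ s (fun u => ((u 0 : ℝ) : ℂ).im) :=
  re_im_ofReal hs ((isSemialgebraicFunOn_aeval hs (X 0)).congr fun u _ => by simp)

/-- **The elliptic integrand.** For constants `x₀, v, g₂, g₃, w ∈ ℂ` with algebraic real and
imaginary parts and a `ℚ`-semialgebraic `s ⊆ ℝ¹` on which
`p(u) = 4 (x₀ + u v)³ − g₂ (x₀ + u v) − g₃` does not vanish, the functions
`u ↦ re (w / √p(u))` and `u ↦ im (w / √p(u))` (principal square root) are `ℚ`-semialgebraic on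
`s`. This is the shape of the integrand of `∫ dx / y` on `y² = 4x³ − g₂ x − g₃` along the segment
`x = x₀ + u v`. [Kontsevich–Zagier 2001, §1.1] [cite: KontsevichZagier2001, §1.1] -/
theorem re_im_ellipticIntegrand {s : Set (Fin 1 → ℝ)} (hs : IsSemialgebraic ℚ s)
    {x₀ v g₂ g₃ w : ℂ}
    (hx₀ : IsAlgebraic ℚ x₀.re ∧ IsAlgebraic ℚ x₀.im) (hv : IsAlgebraic ℚ v.re ∧ IsAlgebraic ℚ v.im)
    (hg₂ : IsAlgebraic ℚ g₂.re ∧ IsAlgebraic ℚ g₂.im) (hg₃ : IsAlgebraic ℚ g₃.re ∧ IsAlgebraic ℚ g₃.im)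
    (hw : IsAlgebraic ℚ w.re ∧ IsAlgebraic ℚ w.im)
    (hp : ∀ u ∈ s, 4 * (x₀ + (u 0 : ℂ) * v) ^ 3 - g₂ * (x₀ + (u 0 : ℂ) * v) - g₃ ≠ 0) :
    IsSemialgebraicFunOn ℚ s
        (fun u => (w / Complex.sqrt (4 * (x₀ + (u 0 : ℂ) * v) ^ 3 - g₂ * (x₀ + (u 0 : ℂ) * v) - g₃)).re) ∧
      IsSemialgebraicFunOn ℚ s
        (fun u => (w / Complex.sqrt (4 * (x₀ + (u 0 : ℂ) * v) ^ 3 - g₂ * (x₀ + (u 0 : ℂ) * v) - g₃)).im) := by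
  have hX : IsSemialgebraicFunOn ℚ s (fun u => (x₀ + (u 0 : ℂ) * v).re) ∧
      IsSemialgebraicFunOn ℚ s (fun u => (x₀ + (u 0 : ℂ) * v).im) :=
    re_im_add (re_im_const hs hx₀.1 hx₀.2) (re_im_mul (re_im_coord hs) (re_im_const hs hv.1 hv.2))
  have h4 : IsSemialgebraicFunOn ℚ s (fun _ => (4 : ℂ).re) ∧
      IsSemialgebraicFunOn ℚ s (fun _ => (4 : ℂ).im) := by
    refine ⟨?_, ?_⟩
    · simpa using isSemialgebraicFunOn_natCast (k := ℚ) (R := ℝ) hs 4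
    · simpa using isSemialgebraicFunOn_natCast (k := ℚ) (R := ℝ) hs 0
  have hP : IsSemialgebraicFunOn ℚ s
      (fun u => (4 * (x₀ + (u 0 : ℂ) * v) ^ 3 - g₂ * (x₀ + (u 0 : ℂ) * v) - g₃).re) ∧
      IsSemialgebraicFunOn ℚ s
      (fun u => (4 * (x₀ + (u 0 : ℂ) * v) ^ 3 - g₂ * (x₀ + (u 0 : ℂ) * v) - g₃).im) :=
    re_im_sub (re_im_sub (re_im_mul h4 (re_im_pow hs hX 3))
      (re_im_mul (re_im_const hs hg₂.1 hg₂.2) hX)) (re_im_const hs hg₃.1 hg₃.2)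
  have hsqrt := re_im_sqrt hP
  have h0 : ∀ u ∈ s,
      Complex.sqrt (4 * (x₀ + (u 0 : ℂ) * v) ^ 3 - g₂ * (x₀ + (u 0 : ℂ) * v) - g₃) ≠ 0 := by
    intro u hu h
    rw [Complex.sqrt, Complex.cpow_eq_zero_iff] at h
    exact hp u hu h.1
  exact re_im_div (re_im_const hs hw.1 hw.2) hsqrt h0

end ComplexValued

end Literature.NumberTheory.Transcendental
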